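import Literature.NumberTheory.Sieve.Maynard2016Lemma93ErrorChain
import Literature.NumberTheory.Sieve.Maynard2016Lemma93EmModulus
import Literature.NumberTheory.Sieve.Maynard2016Lemma93CFree
import HarnessLib

/-!
# Maynard 2016, proof of Lemma 9.3 — the error term of (9.26) bounded by the `e_m`-sum of `Y_{r'}`

Sources: J. Maynard, *Dense clusters of primes in subsets*, Compositio Math. 152 (2016) 1517–1554 =
arXiv:1405.2593 [Maynard2016DenseClusters], proof of Lemma 9.3, p. 24 (display (9.26), the first display of
p. 24 and the display «Thus, relaxing the constraint `(e_m, rW_m) = 1` … we see the error contributes a total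
≪ T_k (log log R)²/log R · r/φ_L(r) · ∑_{(e_m, a_m W B r)=1} Y_{r'}/φ_ω(e_m)»);
K. Ford, B. Green, S. Konyagin, J. Maynard, T. Tao, *Long gaps between primes*, JAMS 31 (2018)
[FordGreenKonyaginMaynardTao2018], §7 (7.5), (7.8), Theorem 6 (7.13).

Continuation of `Maynard2016Lemma93ErrorChain`. With the exact main/error splitting of
`FGKMT2018.yVarM_eq_main_add_err` (`Maynard2016Lemma93MainSkeleton`), this file bounds the ERROR part:

* §1 (9.26) pointwise: for `e = r' ⊙ q` (`qᵢ ≥ 1`), `|y_e − y_{r'}| ≤ (30 + 30/U_k + T_k)·P·(log ∏qᵢ/log R)·F₂(u(r'))`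
  (`abs_yVar_mul_sub_le`, from the tree's Lemma 8.2 `FGKMT2018.abs_yVar_sub_yVar_le`), and the vanishing
  `y_e = 0` when a coordinate is `≥ R` (`yVar_F_eq_zero_of_le`);
* §2 the weight comparison on admissible `c = e_m`: `1/φ_ω(c) ≤ emWeight (a_m WB ∏r W_m) ω c`
  (`inv_phiOmega_le_emWeight`: `X_p ≤ 1` because `ω(p) ≥ 1` at the primes of `c`), so that the `e_m`-sum of
  `Y_{r'}/φ_ω(e_m)` over `e_m < R` is at most the tree's `MaynardDense.emSum` with the `F₂`-fibre
  (`sum_F₂_div_phiOmega_le_emSum`; «relaxing the constraint `(e_m, rW_m) = 1`» is an inequality in the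
  other direction for us: we keep the constraint inside `emWeight` and drop nothing);
* §3 the bound (`abs_errM_le`): for admissible non-degenerate `𝓛`, `k ≥ 2`, `B ≠ 0`, `R > 1`, `r ∈ 𝒟'^{(m)}_k`,
  `|ERR(r)| ≤ (30 + 30/U_k + T_k) · P · K_Δ/log R · (∏r/φ_L(∏r)) · emSum(a_m WB ∏r W_m, ω, F₂(u(r); u_m := ·), R)`,
  `K_Δ = 2e⁶e^{2e⁶} ∏_{p∣Δ*_m}(1 + 1/p)(1 + ∑_{p∣Δ*_m} log p/p)` the inner-sum constant of
  `FGKMT2018.sum_qBox_abs_sigmaM_log_le` (the terms with `e_m ≥ R` vanish identically, both `y`'s being `0`).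
  The `e_m`-sum is then `≪ c_γ log R ∫₀^∞ F₂ dt_m` by the tree's `MaynardDense.emSum_F₂_le` (Lemma 8.3), which is
  how the `1/log R` cancels and (9.26)'s error becomes `O(T_k (log log R)² c_m ∫ F₂ dt_m)` in the frame.

No new definitions, no named facts.

## References
* J. Maynard, *Dense clusters of primes in subsets*, Compositio Math. 152 (2016), proof of Lemma 9.3 p. 24,
  (9.26) and the two displays following it [Maynard2016DenseClusters].
* K. Ford, B. Green, S. Konyagin, J. Maynard, T. Tao, *Long gaps between primes*, JAMS 31 (2018), §7 (7.5),
  (7.8), Thm 6 (7.13) [FordGreenKonyaginMaynardTao2018].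
-/

noncomputable section

open Finset
open scoped Nat

namespace Literature.NumberTheory.Sieve

namespace FGKMT2018

variable {k : ℕ}

/-! ### §1 Display (9.26) pointwise, and the vanishing beyond `R` -/

/-- `u(r[j ↦ c]) = u(r)[j ↦ log c/log R]`. [cite: Maynard2016DenseClusters, Lemma 8.2 p. 15 (the substitution u = log r/log R)] -/
theorem logVec_update_eq (R : ℝ) (r : Fin k → ℕ) (j : Fin k) (c : ℕ) :
    logVec R (Function.update r j c) = Function.update (logVec R r) j (Real.log c / Real.log R) := by
  funext i
  unfold logVec
  by_cases hi : i = j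
  · subst hi; simp only [Function.update_self]
  · simp only [Function.update_of_ne hi]

/-- Maynard's `F_k` vanishes as soon as one coordinate is `≥ 1` (inside the orthant).
[cite: Maynard2016DenseClusters, (7.4) p. 13 («F supported on ∑ tᵢ ≤ 1»)] -/
theorem F_eq_zero_of_one_le {u : Fin k → ℝ} (hu : u ∈ MaynardDense.orthant k) (j : Fin k)
    (hj : 1 ≤ u j) : MaynardDense.F k u = 0 := by
  have hsum : 1 ≤ ∑ i, u i :=
    hj.trans (Finset.single_le_sum (fun i _ => MaynardDense.mem_orthant.1 hu i) (Finset.mem_univ j))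
  unfold MaynardDense.F
  rw [MaynardDense.psi_eq_zero hsum, zero_mul]

/-- `y_e = 0` (for `F = F_k`) as soon as one coordinate `e_j ≥ R` (`R > 1`, all `eᵢ ≥ 1`).
[cite: Maynard2016DenseClusters, (7.4) p. 13, (8.6) p. 14 (y supported on ∏ ≤ R)] -/
theorem yVar_F_eq_zero_of_le (L : Fin k → ℤ × ℤ) (B : ℕ) {R : ℝ} (hR : 1 < R) {e : Fin k → ℕ}
    (he : ∀ i, 1 ≤ e i) (j : Fin k) (hj : R ≤ (e j : ℝ)) :
    yVar L B R (MaynardDense.F k) e = 0 := by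
  rw [yVar_eq_mul_F L B hR.le e he]
  have hlogR : 0 < Real.log R := Real.log_pos hR
  have hu : (fun i => Real.log (e i) / Real.log R) ∈ MaynardDense.orthant k :=
    logVec_mem_orthant hR.le e he
  have h1 : 1 ≤ Real.log (e j) / Real.log R := by
    rw [le_div_iff₀ hlogR, one_mul]
    exact Real.log_le_log (by linarith) hj
  rw [F_eq_zero_of_one_le hu j h1, mul_zero]

/-- **Display (9.26) pointwise** (Lemma 8.2 for `e = r' ⊙ q`): for `r'ᵢ, qᵢ ≥ 1` and `R > 1`,
`|y_{r'⊙q} − y_{r'}| ≤ (30 + 30/U_k + T_k) · |P| · (log ∏qᵢ/log R) · F₂(u(r'))`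
(`P = (WB)^k 𝔖_{WB}/φ(WB)^k`, so `|P| F₂(u(r')) = Y_{r'}`: «`y_e = y_{r'} + O(T_k Y_{r'} log(st)/log R)`»).
[cite: Maynard2016DenseClusters, proof of Lemma 9.3 p. 24, display (9.26), from Lemma 8.2 p. 15] -/
theorem abs_yVar_mul_sub_le (hk : 2 ≤ k) (L : Fin k → ℤ × ℤ) (B : ℕ) {R : ℝ} (hR : 1 < R)
    {r' q : Fin k → ℕ} (hr : ∀ i, 1 ≤ r' i) (hq : ∀ i, 1 ≤ q i) :
    |yVar L B R (MaynardDense.F k) (fun i => r' i * q i) - yVar L B R (MaynardDense.F k) r'| ≤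
      (30 + 30 / MaynardDense.U k + MaynardDense.T k) * |yPref L B| *
        (Real.log ((∏ i, q i : ℕ) : ℝ) / Real.log R) * MaynardDense.F₂ k (logVec R r') := by
  have hs : ∀ i, 1 ≤ r' i * q i := fun i => one_le_mul (hr i) (hq i)
  have h := abs_yVar_sub_yVar_le hk L B hR r' (fun i => r' i * q i) (fun i => r' i * q i) hr hs
    (fun i => Nat.le_mul_of_pos_right _ (hq i)) (fun i => le_rfl)
  have h0 : ∑ i, (Real.log ((fun i => r' i * q i) i : ℕ) - Real.log ((fun i => r' i * q i) i : ℕ)) = 0 :=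
    Finset.sum_eq_zero fun i _ => sub_self _
  have h1 : ∑ i, (Real.log ((fun i => r' i * q i) i : ℕ) - Real.log (r' i : ℕ)) =
      Real.log ((∏ i, q i : ℕ) : ℝ) := by
    rw [Nat.cast_prod, Real.log_prod]
    · refine Finset.sum_congr rfl fun i _ => ?_
      have hr0 : (r' i : ℝ) ≠ 0 := by exact_mod_cast (Nat.one_le_iff_ne_zero.1 (hr i))
      have hq0 : (q i : ℝ) ≠ 0 := by exact_mod_cast (Nat.one_le_iff_ne_zero.1 (hq i))
      simp only [Nat.cast_mul]
      rw [Real.log_mul hr0 hq0]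
      ring
    · intro i _
      exact_mod_cast (Nat.one_le_iff_ne_zero.1 (hq i))
  rw [h0, h1, zero_div, zero_mul, add_zero] at h
  unfold yPref logVec
  calc _ ≤ _ := h
    _ = _ := by ring

/-! ### §2 The weight comparison on admissible `e_m` and the `e_m`-sum against `emSum` -/

/-- On the range of `c = e_m` (`r[m↦c] ∈ admBox`, `r ∈ 𝒟'^{(m)}_k`): `1/φ_ω(c) ≤ emWeight (a_m WB ∏r W_m) ω c`,
because `emWeight(c) = (∏_{p∣c} (p − ω(p)) X_p)⁻¹` with `0 < X_p = p/(p−1) − 1/(p − ω(p)) ≤ 1`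
(`ω(p) ≥ 1`: `p ∤ a_m` at the primes of `c`).
[cite: Maynard2016DenseClusters, proof of Lemma 9.3 p. 24, (9.28)–(9.29) and «relaxing the constraint (e_m, rW_m) = 1»] -/
theorem inv_phiOmega_le_emWeight {L : Fin k → ℤ × ℤ} (hadm : FormsAdmissible L) {B : ℕ} {R : ℝ}
    {m : Fin k} {r : Fin k → ℕ} (hr : r ∈ dkBoxP L B R m) {c : ℕ}
    (hc : Function.update r m c ∈ admBox L B R) :
    1 / phiOmega L c ≤
      MaynardDense.emWeight (emModulus L B (primorial ⌊R⌋₊) m (∏ i, r i)) (omegaL L) c := by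
  obtain ⟨hcN, hcop⟩ := (update_mem_admBox_iff hadm hr c).1 hc
  have hsq : Squarefree c := (squarefree_primorial ⌊R⌋₊).squarefree_of_dvd hcN
  rw [MaynardDense.emWeight_of (omegaL L) ⟨hsq, hcop⟩, one_div]
  have hω : ∀ p : ℕ, p.Prime → omegaL L p < p := ((formsAdmissible_iff_omegaL L).1 hadm).2
  have hφ : 0 < phiOmega L c :=
    phiOmega_pos_of_forall_lt L fun p hp => hω p (Nat.prime_of_mem_primeFactors hp)
  -- termwise `0 < emA(p) ≤ p − ω(p)`
  have hterm : ∀ p ∈ c.primeFactors, 0 < MaynardDense.emA (omegaL L) p ∧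
      MaynardDense.emA (omegaL L) p ≤ (p : ℝ) - omegaL L p := by
    intro p hp
    have hpp : p.Prime := Nat.prime_of_mem_primeFactors hp
    have hωp := hω p hpp
    obtain ⟨-, -, -, hpa⟩ := prime_of_dvd_admissible_c hadm hr hc hp
    have hω1 : (1 : ℝ) ≤ omegaL L p := by exact_mod_cast one_le_omegaL_of_not_dvd hadm m hpp hpa
    have hωlt : (omegaL L p : ℝ) < p := by exact_mod_cast hωp
    have hp1 : 0 < (p : ℝ) - 1 := by
      have : (1 : ℝ) < p := by exact_mod_cast hpp.one_lt
      linarith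
    refine ⟨MaynardDense.emA_pos (omegaL L) hpp hωp, ?_⟩
    rw [MaynardDense.emA_eq_phi_mul (omegaL L) hpp hωp]
    -- `X_p ≤ 1`
    have hX : (p : ℝ) / ((p : ℝ) - 1) - 1 / ((p : ℝ) - omegaL L p) ≤ 1 := by
      rw [div_sub_div _ _ hp1.ne' (by linarith : ((p : ℝ) - omegaL L p) ≠ 0),
        div_le_one (mul_pos hp1 (by linarith))]
      nlinarith
    calc ((p : ℝ) - omegaL L p) * ((p : ℝ) / ((p : ℝ) - 1) - 1 / ((p : ℝ) - omegaL L p))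
        ≤ ((p : ℝ) - omegaL L p) * 1 := mul_le_mul_of_nonneg_left hX (by linarith)
      _ = _ := mul_one _
  have hA : 0 < ∏ p ∈ c.primeFactors, MaynardDense.emA (omegaL L) p :=
    Finset.prod_pos fun p hp => (hterm p hp).1
  rw [inv_le_inv₀ hφ hA]
  unfold phiOmega
  exact Finset.prod_le_prod (fun p hp => (hterm p hp).1.le) fun p hp => (hterm p hp).2

/-- **The `e_m`-sum of `Y_{r'}/φ_ω(e_m)` against `emSum`**: for `r ∈ 𝒟'^{(m)}_k`, `R > 1`,
`∑_{c ∣ ⌊R⌋#, r[m↦c] ∈ admBox, c < R} F₂(u(r[m↦c]))/φ_ω(c) ≤ emSum (a_m WB ∏r W_m) ω (t ↦ F₂(u(r); u_m := t)) R`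
(the summands on the left are among those of `emSum` with smaller weights, all summands `≥ 0`).
[cite: Maynard2016DenseClusters, proof of Lemma 9.3 p. 24 («Thus, relaxing the constraint … and using Lemma 8.4 to estimate the sum over e_m»)] -/
theorem sum_F₂_div_phiOmega_le_emSum {L : Fin k → ℤ × ℤ} (hadm : FormsAdmissible L) (hk : 2 ≤ k)
    {B : ℕ} {R : ℝ} (hR : 1 < R) {m : Fin k} {r : Fin k → ℕ} (hr : r ∈ dkBoxP L B R m) :
    ∑ c ∈ ((primorial ⌊R⌋₊).divisors.filter
        (fun c => Function.update r m c ∈ admBox L B R)).filter (fun c : ℕ => (c : ℝ) < R),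
      MaynardDense.F₂ k (Function.update (logVec R r) m (Real.log c / Real.log R)) / phiOmega L c ≤
    MaynardDense.emSum (emModulus L B (primorial ⌊R⌋₊) m (∏ i, r i)) (omegaL L)
      (fun t => MaynardDense.F₂ k (Function.update (logVec R r) m t)) R := by
  classical
  have hN : primorial ⌊R⌋₊ ≠ 0 := primorial_ne_zero _
  have hr1 : ∀ i, 1 ≤ r i := one_le_of_mem_dkBox (dkBoxP_subset L B R m hr)
  have hω : ∀ p : ℕ, p.Prime → omegaL L p < p := ((formsAdmissible_iff_omegaL L).1 hadm).2
  have hu : logVec R r ∈ MaynardDense.orthant k := logVec_mem_orthant hR.le r hr1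
  have hlogR : 0 < Real.log R := Real.log_pos hR
  unfold MaynardDense.emSum
  set S := ((primorial ⌊R⌋₊).divisors.filter
      (fun c => Function.update r m c ∈ admBox L B R)).filter (fun c : ℕ => (c : ℝ) < R) with hS
  -- the range is inside `Ico 1 ⌈R⌉₊`
  have hsub : S ⊆ Finset.Ico 1 ⌈R⌉₊ := by
    intro c hc
    obtain ⟨hc1, hcR⟩ := Finset.mem_filter.1 hc
    obtain ⟨hcd, -⟩ := Finset.mem_filter.1 hc1
    exact Finset.mem_Ico.2 ⟨Nat.pos_of_mem_divisors hcd, Nat.lt_ceil.2 hcR⟩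
  -- termwise comparison on `S`
  have hle : ∀ c ∈ S, MaynardDense.F₂ k (Function.update (logVec R r) m (Real.log c / Real.log R)) /
      phiOmega L c ≤
      MaynardDense.emWeight (emModulus L B (primorial ⌊R⌋₊) m (∏ i, r i)) (omegaL L) c *
        MaynardDense.F₂ k (Function.update (logVec R r) m (Real.log c / Real.log R)) := by
    intro c hc
    obtain ⟨hc1, -⟩ := Finset.mem_filter.1 hc
    obtain ⟨hcd, hadmc⟩ := Finset.mem_filter.1 hc1
    have hc0 : (1 : ℝ) ≤ c := by exact_mod_cast Nat.pos_of_mem_divisors hcd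
    have hF : 0 ≤ MaynardDense.F₂ k (Function.update (logVec R r) m (Real.log c / Real.log R)) :=
      MaynardDense.F₂_nonneg hk (MaynardDense.update_mem_orthant hu m
        (div_nonneg (Real.log_nonneg hc0) hlogR.le))
    rw [div_eq_mul_one_div, mul_comm]
    exact mul_le_mul_of_nonneg_right (inv_phiOmega_le_emWeight hadm hr hadmc) hF
  refine (Finset.sum_le_sum hle).trans ?_
  refine Finset.sum_le_sum_of_subset_of_nonneg hsub fun e he _ => ?_
  have he1 : (1 : ℝ) ≤ e := by exact_mod_cast (Finset.mem_Ico.1 he).1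
  exact mul_nonneg
    (MaynardDense.emWeight_nonneg fun p hp => hω p (Nat.prime_of_mem_primeFactors hp))
    (MaynardDense.F₂_nonneg hk (MaynardDense.update_mem_orthant hu m
      (div_nonneg (Real.log_nonneg he1) hlogR.le)))


/-! ### §3 The error term of `yVarM_eq_main_add_err`, bounded -/

/-- **Maynard 2016, proof of Lemma 9.3 — the error of (9.26) summed** («we see the error contributes a total
≪ T_k (log log R)²/log R · r/φ_L(r) · ∑_{e_m} Y_{r'}/φ_ω(e_m)»): for admissible non-degenerate `𝓛`, `k ≥ 2`,
`R > 1` and `r ∈ 𝒟'^{(m)}_k`, the error part of `FGKMT2018.yVarM_eq_main_add_err` satisfies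
`|ERR(r)| ≤ (30 + 30/U_k + T_k)·|P|·K_Δ/log R · (∏r/φ_L(∏r)) · emSum(a_m WB ∏r W_m, ω, t ↦ F₂(u(r); u_m := t), R)`
with `K_Δ = 2e⁶e^{2e⁶} ∏_{p∣Δ*_m}(1 + 1/p)(1 + ∑_{p∣Δ*_m} log p/p)` (`FGKMT2018.sum_qBox_abs_sigmaM_log_le`); the
terms with `e_m ≥ R` vanish identically. Combined with `MaynardDense.emSum_F₂_le` (the `e_m`-summation,
Lemma 8.3) this is the `O(T_k (log log R)² c_m ∫F₂ dt_m)` error of Lemma 9.3 before the frame bounds.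
[cite: Maynard2016DenseClusters, proof of Lemma 9.3 p. 24, (9.26) and the two displays following it] -/
theorem abs_errM_le {L : Fin k → ℤ × ℤ} (hadm : FormsAdmissible L) (hnd : FormsNondegenerate L)
    (hk : 2 ≤ k) (B : ℕ) {R : ℝ} (hR : 1 < R) {m : Fin k} {r : Fin k → ℕ} (hr : r ∈ dkBoxP L B R m) :
    |((∏ i, r i : ℕ) : ℝ) / totForm (L m) (∏ i, r i) *
        ∑ c ∈ (primorial ⌊R⌋₊).divisors.filter (fun c => Function.update r m c ∈ admBox L B R),
          1 / phiOmega L c *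
            ∑ q ∈ qBox L B (primorial ⌊R⌋₊) m (∏ i, Function.update r m c i),
              (yVar L B R (MaynardDense.F k) (fun i => Function.update r m c i * q i) -
                  yVar L B R (MaynardDense.F k) (Function.update r m c)) * sigmaM L m q /
                phiOmega L (∏ i, q i)| ≤
      (30 + 30 / MaynardDense.U k + MaynardDense.T k) * |yPref L B| *
        (2 * Real.exp 6 * Real.exp (2 * Real.exp 6) *
          (∏ p ∈ (∏ j ∈ Finset.univ.erase m, (crossDet L m j).natAbs).primeFactors, (1 + 1 / (p : ℝ))) *
          (1 + ∑ p ∈ (∏ j ∈ Finset.univ.erase m, (crossDet L m j).natAbs).primeFactors,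
            Real.log p / p)) / Real.log R *
        (((∏ i, r i : ℕ) : ℝ) / totForm (L m) (∏ i, r i)) *
        MaynardDense.emSum (emModulus L B (primorial ⌊R⌋₊) m (∏ i, r i)) (omegaL L)
          (fun t => MaynardDense.F₂ k (Function.update (logVec R r) m t)) R := by
  classical
  have hN : primorial ⌊R⌋₊ ≠ 0 := primorial_ne_zero _
  have hNsq : Squarefree (primorial ⌊R⌋₊) := squarefree_primorial _
  set c82 : ℝ := 30 + 30 / MaynardDense.U k + MaynardDense.T k with hc82
  set P : ℝ := |yPref L B| with hPdef
  set KΔ : ℝ := 2 * Real.exp 6 * Real.exp (2 * Real.exp 6) *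
      (∏ p ∈ (∏ j ∈ Finset.univ.erase m, (crossDet L m j).natAbs).primeFactors, (1 + 1 / (p : ℝ))) *
      (1 + ∑ p ∈ (∏ j ∈ Finset.univ.erase m, (crossDet L m j).natAbs).primeFactors, Real.log p / p)
    with hKΔdef
  set pref : ℝ := ((∏ i, r i : ℕ) : ℝ) / totForm (L m) (∏ i, r i) with hprefdef
  set S := (primorial ⌊R⌋₊).divisors.filter (fun c => Function.update r m c ∈ admBox L B R) with hSdef
  have hr1 : ∀ i, 1 ≤ r i := one_le_of_mem_dkBox (dkBoxP_subset L B R m hr)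
  have hω : ∀ p : ℕ, p.Prime → omegaL L p < p := ((formsAdmissible_iff_omegaL L).1 hadm).2
  have hlogR : 0 < Real.log R := Real.log_pos hR
  have hk1 : 1 ≤ k := le_trans (by norm_num) hk
  have hc82pos : 0 ≤ c82 := by
    have := MaynardDense.U_pos hk1
    have := MaynardDense.T_pos hk
    positivity
  have hP0 : 0 ≤ P := abs_nonneg _
  have hprod0 : (∏ i, r i) ≠ 0 := Finset.prod_ne_zero_iff.2 fun i _ => Nat.one_le_iff_ne_zero.1 (hr1 i)
  have hpref0 : 0 ≤ pref :=
    div_nonneg (Nat.cast_nonneg _) (totForm_pos (L m) (hadm.1 m) hprod0).le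
  have hKΔ0 : 0 ≤ KΔ := by
    have h1 : 0 ≤ ∏ p ∈ (∏ j ∈ Finset.univ.erase m, (crossDet L m j).natAbs).primeFactors,
        (1 + 1 / (p : ℝ)) := Finset.prod_nonneg fun p _ => by positivity
    have h2 : 0 ≤ ∑ p ∈ (∏ j ∈ Finset.univ.erase m, (crossDet L m j).natAbs).primeFactors,
        Real.log p / p := Finset.sum_nonneg fun p hp => by
      have hpP := Nat.prime_of_mem_primeFactors hp
      exact div_nonneg (Real.log_nonneg (by exact_mod_cast hpP.one_lt.le)) (by positivity)
    positivity
  have hu : logVec R r ∈ MaynardDense.orthant k := logVec_mem_orthant hR.le r hr1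
  have hG0 : ∀ c : ℕ, 1 ≤ c →
      0 ≤ MaynardDense.F₂ k (Function.update (logVec R r) m (Real.log c / Real.log R)) := by
    intro c hc
    have hc' : (1 : ℝ) ≤ c := by exact_mod_cast hc
    exact MaynardDense.F₂_nonneg hk
      (MaynardDense.update_mem_orthant hu m (div_nonneg (Real.log_nonneg hc') hlogR.le))
  -- the inner `q`-sums
  have hinner : ∀ c ∈ S,
      |∑ q ∈ qBox L B (primorial ⌊R⌋₊) m (∏ i, Function.update r m c i),
          (yVar L B R (MaynardDense.F k) (fun i => Function.update r m c i * q i) -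
              yVar L B R (MaynardDense.F k) (Function.update r m c)) * sigmaM L m q /
            phiOmega L (∏ i, q i)| ≤
        if (c : ℝ) < R then
          c82 * P * MaynardDense.F₂ k (Function.update (logVec R r) m (Real.log c / Real.log R)) /
            Real.log R * KΔ
        else 0 := by
    intro c hc
    obtain ⟨hcd, hadmc⟩ := Finset.mem_filter.1 hc
    have hc1 : 1 ≤ c := Nat.pos_of_mem_divisors hcd
    have hr'1 : ∀ i, 1 ≤ Function.update r m c i := one_le_of_mem_admBox hadmc
    have hq1 : ∀ q ∈ qBox L B (primorial ⌊R⌋₊) m (∏ i, Function.update r m c i), ∀ i, 1 ≤ q i :=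
      fun q hq => one_le_of_mem_admBoxN hN (mem_qBox_iff.1 hq).1
    split_ifs with hcR
    · have hGc := hG0 c hc1
      calc |∑ q ∈ qBox L B (primorial ⌊R⌋₊) m (∏ i, Function.update r m c i),
              (yVar L B R (MaynardDense.F k) (fun i => Function.update r m c i * q i) -
                  yVar L B R (MaynardDense.F k) (Function.update r m c)) * sigmaM L m q /
                phiOmega L (∏ i, q i)|
          ≤ ∑ q ∈ qBox L B (primorial ⌊R⌋₊) m (∏ i, Function.update r m c i),
              |(yVar L B R (MaynardDense.F k) (fun i => Function.update r m c i * q i) -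
                  yVar L B R (MaynardDense.F k) (Function.update r m c)) * sigmaM L m q /
                phiOmega L (∏ i, q i)| := Finset.abs_sum_le_sum_abs _ _
        _ ≤ ∑ q ∈ qBox L B (primorial ⌊R⌋₊) m (∏ i, Function.update r m c i),
              c82 * P * (Real.log ((∏ i, q i : ℕ) : ℝ) / Real.log R) *
                MaynardDense.F₂ k (Function.update (logVec R r) m (Real.log c / Real.log R)) *
                (|sigmaM L m q| / phiOmega L (∏ i, q i)) := by
            refine Finset.sum_le_sum fun q hq => ?_
            have hφq : 0 < phiOmega L (∏ i, q i) :=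
              phiOmega_pos_of_forall_lt L fun p hp => hω p (Nat.prime_of_mem_primeFactors hp)
            rw [abs_div, abs_mul, abs_of_pos hφq]
            have h := abs_yVar_mul_sub_le hk L B hR hr'1 (hq1 q hq)
            rw [logVec_update_eq] at h
            calc |yVar L B R (MaynardDense.F k) (fun i => Function.update r m c i * q i) -
                    yVar L B R (MaynardDense.F k) (Function.update r m c)| * |sigmaM L m q| /
                  phiOmega L (∏ i, q i)
                ≤ c82 * P * (Real.log ((∏ i, q i : ℕ) : ℝ) / Real.log R) *
                    MaynardDense.F₂ k (Function.update (logVec R r) m (Real.log c / Real.log R)) *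
                    |sigmaM L m q| / phiOmega L (∏ i, q i) :=
                  div_le_div_of_nonneg_right (mul_le_mul_of_nonneg_right h (abs_nonneg _)) hφq.le
              _ = _ := by ring
        _ = c82 * P * MaynardDense.F₂ k (Function.update (logVec R r) m (Real.log c / Real.log R)) /
              Real.log R *
              ∑ q ∈ qBox L B (primorial ⌊R⌋₊) m (∏ i, Function.update r m c i),
                |sigmaM L m q| / phiOmega L (∏ i, q i) * Real.log ((∏ i, q i : ℕ) : ℝ) := by
            rw [Finset.mul_sum]
            refine Finset.sum_congr rfl fun q _ => ?_
            ring
        _ ≤ c82 * P * MaynardDense.F₂ k (Function.update (logVec R r) m (Real.log c / Real.log R)) /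
              Real.log R * KΔ := by
            refine mul_le_mul_of_nonneg_left ?_ (by positivity)
            exact sum_qBox_abs_sigmaM_log_le hadm hnd hk B hNsq m _
    · have hcR' : R ≤ (c : ℝ) := not_lt.1 hcR
      rw [Finset.sum_eq_zero, abs_zero]
      intro q hq
      have hqm : q m = 1 := (mem_qBox_iff.1 hq).2.1
      have e1 : yVar L B R (MaynardDense.F k) (fun i => Function.update r m c i * q i) = 0 :=
        yVar_F_eq_zero_of_le L B hR (fun i => one_le_mul (hr'1 i) (hq1 q hq i)) m (by
          show R ≤ ((Function.update r m c m * q m : ℕ) : ℝ)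
          rw [Function.update_self, hqm, mul_one]; exact hcR')
      have e2 : yVar L B R (MaynardDense.F k) (Function.update r m c) = 0 :=
        yVar_F_eq_zero_of_le L B hR hr'1 m (by rw [Function.update_self]; exact hcR')
      rw [e1, e2, sub_self, zero_mul, zero_div]
  -- the `c`-sum
  have hφc : ∀ c ∈ S, 0 < phiOmega L c := fun c _ =>
    phiOmega_pos_of_forall_lt L fun p hp => hω p (Nat.prime_of_mem_primeFactors hp)
  have houter : |∑ c ∈ S, 1 / phiOmega L c *
        ∑ q ∈ qBox L B (primorial ⌊R⌋₊) m (∏ i, Function.update r m c i),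
          (yVar L B R (MaynardDense.F k) (fun i => Function.update r m c i * q i) -
              yVar L B R (MaynardDense.F k) (Function.update r m c)) * sigmaM L m q /
            phiOmega L (∏ i, q i)| ≤
      c82 * P * KΔ / Real.log R *
        ∑ c ∈ S.filter (fun c : ℕ => (c : ℝ) < R),
          MaynardDense.F₂ k (Function.update (logVec R r) m (Real.log c / Real.log R)) / phiOmega L c := by
    refine (Finset.abs_sum_le_sum_abs _ _).trans ?_
    calc ∑ c ∈ S, |1 / phiOmega L c *
            ∑ q ∈ qBox L B (primorial ⌊R⌋₊) m (∏ i, Function.update r m c i),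
              (yVar L B R (MaynardDense.F k) (fun i => Function.update r m c i * q i) -
                  yVar L B R (MaynardDense.F k) (Function.update r m c)) * sigmaM L m q /
                phiOmega L (∏ i, q i)|
        ≤ ∑ c ∈ S, 1 / phiOmega L c *
            (if (c : ℝ) < R then
              c82 * P * MaynardDense.F₂ k (Function.update (logVec R r) m (Real.log c / Real.log R)) /
                Real.log R * KΔ
            else 0) := by
          refine Finset.sum_le_sum fun c hc => ?_
          rw [abs_mul, abs_of_pos (one_div_pos.2 (hφc c hc))]
          exact mul_le_mul_of_nonneg_left (hinner c hc) (one_div_pos.2 (hφc c hc)).le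
      _ = c82 * P * KΔ / Real.log R * ∑ c ∈ S.filter (fun c : ℕ => (c : ℝ) < R),
            MaynardDense.F₂ k (Function.update (logVec R r) m (Real.log c / Real.log R)) /
              phiOmega L c := by
          rw [Finset.sum_filter (s := S) (p := fun c : ℕ => (c : ℝ) < R), Finset.mul_sum]
          refine Finset.sum_congr rfl fun c _ => ?_
          split_ifs
          · ring
          · rw [mul_zero, mul_zero]
  have hC := sum_F₂_div_phiOmega_le_emSum hadm hk hR hr
  rw [abs_mul, abs_of_nonneg hpref0]
  have hcoef : 0 ≤ c82 * P * KΔ / Real.log R := by positivity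
  calc pref * |∑ c ∈ S, 1 / phiOmega L c *
          ∑ q ∈ qBox L B (primorial ⌊R⌋₊) m (∏ i, Function.update r m c i),
            (yVar L B R (MaynardDense.F k) (fun i => Function.update r m c i * q i) -
                yVar L B R (MaynardDense.F k) (Function.update r m c)) * sigmaM L m q /
              phiOmega L (∏ i, q i)|
      ≤ pref * (c82 * P * KΔ / Real.log R *
          ∑ c ∈ S.filter (fun c : ℕ => (c : ℝ) < R),
            MaynardDense.F₂ k (Function.update (logVec R r) m (Real.log c / Real.log R)) /
              phiOmega L c) := mul_le_mul_of_nonneg_left houter hpref0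
    _ ≤ pref * (c82 * P * KΔ / Real.log R *
          MaynardDense.emSum (emModulus L B (primorial ⌊R⌋₊) m (∏ i, r i)) (omegaL L)
            (fun t => MaynardDense.F₂ k (Function.update (logVec R r) m t)) R) :=
        mul_le_mul_of_nonneg_left (mul_le_mul_of_nonneg_left hC hcoef) hpref0
    _ = _ := by ring

end FGKMT2018

end Literature.NumberTheory.Sieve
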